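import Summits.FinalStateConjecture.FinalStateConjecture.Theorems.SwallowTheDatumParametricKerrBurialEngine
import Summits.FinalStateConjecture.FinalStateConjecture.Theorems.SwallowTheDatumParametricKerrBurialCollarLine
import Summits.FinalStateConjecture.FinalStateConjecture.Theorems.SwallowTheDatumParametricKerrBurialStubEndChartDatum
import Literature.Geometry.Lorentzian.InitialDataDilation
import Literature.Geometry.Manifold.ModelSpaceBilinSection

/-!
# `ParametricKerrBurial`, line `receding-annulus-universal-collar` — stub
# `stub_unitAnnulusGluing_of_gluingFamily` (RED) (crux item stmt-FinalStateConjecture-10052)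

The registered stub `stub_unitAnnulusGluing_of_gluingFamily`, proved: the unit-scale PARAMETRIC
obstruction-free annular gluing onto a fixed exterior Schwarzschild slice (the atom A1 of the line)
follows from

* the posited parametric Mao–Oh–Tao theorem `GluingFamilyFor η` (gen-1 Engine vocabulary, §1),
* the explicit Schwarzschild OUT-site package `SchwDatum m S`, `SchwOutSite η εo μo m sOut θ`
  (Engine §3; Mao–Oh–Tao 2023, Rem 1.11), and
* the charge bound: the four η-averaged linear charges of a nearly flat `C¹` pair on the unit
  annulus are `≤ C_η ×` its `C² × C¹` deviation.

Plumbing only.  Fix a bump `η`, the thresholds `εo, μo` of the family theorem, a Schwarzschild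
site `(m, sOut, θ)` with its smoothed datum `S`, and `C_η`; put `δ₀ := min θ (θ/C_η)`.  Given the
in-family `I R` (sections jointly smooth on `{R⋆ < R} × {1/2 < ‖y‖}`, vacuum on `{1/2 < ‖y‖}`,
`δ₀`-flat in `C² × C¹` on `{1 ≤ ‖y‖ ≤ 4}`):

1. CUT-OFF (`unitGluing_exists_cutoffDatum`, Corvino 2000, §4): `h = χ δ + (1 − χ) h_{I R}`,
   `k = (1 − χ) k_{I R}` with `χ(y) = S(4 − ‖y‖²/ρ²)`, `ρ = 9/20` (`χ = 1` on `{‖y‖ < 27/40}`,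
   `χ = 0` on `{9/10 ≤ ‖y‖}`), a datum `Din R` on `ℝ³` for every `R`, equal to `I R` on
   `{9/10 ≤ ‖y‖}` and flat near the closed ball `‖y‖ ≤ 1/2`; hence its coefficient fields are
   jointly `C^∞` on `{R⋆ < R} × ℝ³` (bundle smoothness over the model space is plain smoothness,
   `contMDiffOn_bilinSection_model_iff`);
2. PER-`R` HYPOTHESES: vacuum on `{1 < ‖y‖ < 2}` and `DevLE … 1 2 δ₀` by locality (the
   constraint map and iterated derivatives only see germs, `isVacuumAt_congr`,
   `Filter.EventuallyEq.iteratedFDeriv`), charges `≤ C_η δ₀ ≤ θ`, so `SchwOutSite` gives the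
   hypothesis block `MOTHyp` against `S`, which is vacuum on `{32 < ‖y‖ < 64}`;
3. APPLY `GluingFamilyFor η` with `t₀ = R⋆`, out-datum `S`; READ BACK: joint smoothness on
   `{R⋆ < R} × {1 < ‖y‖}` (`unitGluing_smoothSectionsOn_of_contDiffOn`), vacuum on `{1 < ‖y‖}`
   (glued datum below radius `64`, `S` beyond `32` by locality), agreement with `I R` on
   `{1 < ‖y‖ < 2}` (there `Din R = I R`), exact isotropic Schwarzschild(`m`) beyond `32`.

References: Mao–Oh–Tao 2023, Thm 1.7, Rem 1.9, Rem 1.11; Corvino 2000, §4; Bartnik–Isenberg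
2004, §2 (locality of the constraints); O'Neill 1983, Ch. 3, Def. 3.9.
-/

-- the doubled `FinalStateConjecture` path component is the summit/problem naming scheme, not a mistake
set_option linter.dupNamespace false
-- instance problems on the nested operator type `E3 →L[ℝ] E3 →L[ℝ] ℝ` (e.g. `IsBoundedSMul ℝ _`, used by
-- `ContDiff.smul`) need one more level of pending instance synthesis than the default
set_option maxSynthPendingDepth 2

noncomputable section

namespace Summit.FinalStateConjecture.FinalStateConjecture.Theorems.SwallowTheDatum.ParametricKerrBurial

open scoped Manifold ContDiff Topology BigOperators InnerProductSpace RealInnerProductSpace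
-- NB: no `open Bundle` (instance synthesis time-outs downstream); `Bundle.TotalSpace.mk'` is qualified.
open Set Filter Function Literature.Geometry.Lorentzian Literature.Geometry.Manifold
open Literature.Geometry.Lorentzian.MaoOhTao Literature.Geometry.Lorentzian.InitialDataSet

/-! ## §1 Cut-off data on `ℝ³`; plain versus bundle joint smoothness -/

/-- **Cut-off interpolation between a constant form and a datum on `ℝ³`.** For a constant
symmetric positive definite bilinear form `δ` on `E3`, a smooth cut-off `χ : E3 → [0, 1]` and a
datum `D` on `ℝ³`, the fields `χ δ + (1 − χ) h_D` and `(1 − χ) k_D` are the coordinate readings of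
an initial data set on `ℝ³` (smooth; positive definite as a convex combination of `δ` and the
positive definite `h_D`). Corvino 2000, §4 (cut-off patching). [cite: Corvino2000, §4] -/
theorem unitGluing_exists_cutoffDatum (δ : E3 →L[ℝ] E3 →L[ℝ] ℝ) (hδs : ∀ v w, δ v w = δ w v)
    (hδp : ∀ v, v ≠ 0 → 0 < δ v v) {χ : E3 → ℝ} (hχs : ContDiff ℝ ∞ χ)
    (hχ01 : ∀ y, 0 ≤ χ y ∧ χ y ≤ 1) (D : InitialDataSet (𝓡 3) E3) :
    ∃ I₀ : InitialDataSet (𝓡 3) E3,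
      I₀.coordH = (fun y ↦ χ y • δ + (1 - χ y) • D.coordH y) ∧
        I₀.coordK = fun y ↦ (1 - χ y) • D.coordK y :=
  exists_initialDataSet_of_contDiff _ _
    ((hχs.smul contDiff_const).add ((contDiff_const.sub hχs).smul D.contMDiff_coordH.contDiff))
    ((contDiff_const.sub hχs).smul D.contMDiff_coordK.contDiff)
    (fun y v w ↦ by
      simp only [add_apply, smul_apply, smul_eq_mul, hδs v w, coordH_apply]
      rw [D.h.symm y v w])
    (fun y v hv ↦ by
      obtain ⟨h0, h1⟩ := hχ01 y
      have hp : 0 < D.coordH y v v := D.h.pos y v hv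
      have hvv : 0 < δ v v := hδp v hv
      simp only [add_apply, smul_apply, smul_eq_mul]
      rcases h1.lt_or_eq with h1 | h1
      · exact add_pos_of_nonneg_of_pos (mul_nonneg h0 hvv.le) (mul_pos (sub_pos.2 h1) hp)
      · rw [h1, sub_self, zero_mul, add_zero, one_mul]
        exact hvv)
    (fun y v w ↦ by
      simp only [smul_apply, smul_eq_mul, coordK_apply]
      rw [D.k_symm y v w])

/-- **Plain joint smoothness of the coefficient fields of a family of data on `ℝ³`** with sections
jointly smooth on an open set `s ⊆ ℝ × ℝ³` (bundle smoothness over the model space is plain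
smoothness, `contMDiffOn_bilinSection_model_iff`; the product model of `ℝ × E3` is the self model,
`modelWithCornersSelf_prod`). [folklore] -/
theorem unitGluing_contDiffOn_coord_of_smoothSectionsOn {O : ℝ → InitialDataSet (𝓡 3) E3}
    {s : Set (ℝ × E3)} (hs : IsOpen s) (hO : SmoothSectionsOn 𝓘(ℝ, ℝ) O s) :
    ContDiffOn ℝ ∞ (fun p : ℝ × E3 ↦ (O p.1).coordH p.2) s ∧
      ContDiffOn ℝ ∞ (fun p : ℝ × E3 ↦ (O p.1).coordK p.2) s := by
  have hH := ((contMDiffOn_bilinSection_model_iff (IQ := 𝓘(ℝ, ℝ).prod 𝓘(ℝ, E3))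
    (b := fun p : ℝ × E3 ↦ p.2) (s := fun p : ℝ × E3 ↦ (O p.1).coordH p.2) hs).1 hO.1).2
  have hK := ((contMDiffOn_bilinSection_model_iff (IQ := 𝓘(ℝ, ℝ).prod 𝓘(ℝ, E3))
    (b := fun p : ℝ × E3 ↦ p.2) (s := fun p : ℝ × E3 ↦ (O p.1).coordK p.2) hs).1 hO.2).2
  constructor
  · rw [← contMDiffOn_iff_contDiffOn, modelWithCornersSelf_prod, ← chartedSpaceSelf_prod]
    exact hH
  · rw [← contMDiffOn_iff_contDiffOn, modelWithCornersSelf_prod, ← chartedSpaceSelf_prod]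
    exact hK

/-- **Bundle joint smoothness from plain joint smoothness**: if the two coefficient fields of a
family of data on `ℝ³` are jointly `C^∞` on `{R⋆ < t} × ℝ³`, its sections are jointly smooth on
every open `s ⊆ {R⋆ < t} × ℝ³`. [folklore] -/
theorem unitGluing_smoothSectionsOn_of_contDiffOn {O : ℝ → InitialDataSet (𝓡 3) E3} {Rstar : ℝ}
    {s : Set (ℝ × E3)} (hs : IsOpen s) (hsub : s ⊆ {t | Rstar < t} ×ˢ (univ : Set E3))
    (hH : ContDiffOn ℝ ∞ (fun p : ℝ × E3 ↦ (O p.1).coordH p.2) ({t | Rstar < t} ×ˢ univ))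
    (hK : ContDiffOn ℝ ∞ (fun p : ℝ × E3 ↦ (O p.1).coordK p.2) ({t | Rstar < t} ×ˢ univ)) :
    SmoothSectionsOn 𝓘(ℝ, ℝ) O s := by
  have toM : ∀ {f : ℝ × E3 → E3 →L[ℝ] E3 →L[ℝ] ℝ},
      ContDiffOn ℝ ∞ f ({t | Rstar < t} ×ˢ (univ : Set E3)) →
        ContMDiffOn (𝓘(ℝ, ℝ).prod 𝓘(ℝ, E3)) 𝓘(ℝ, E3 →L[ℝ] E3 →L[ℝ] ℝ) ∞ f s := by
    intro f hf
    have h := hf.mono hsub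
    rw [← contMDiffOn_iff_contDiffOn, modelWithCornersSelf_prod, ← chartedSpaceSelf_prod] at h
    exact h
  exact ⟨(contMDiffOn_bilinSection_model_iff (IQ := 𝓘(ℝ, ℝ).prod 𝓘(ℝ, E3))
      (b := fun p : ℝ × E3 ↦ p.2) (s := fun p : ℝ × E3 ↦ (O p.1).coordH p.2) hs).2
      ⟨contMDiffOn_snd, toM hH⟩,
    (contMDiffOn_bilinSection_model_iff (IQ := 𝓘(ℝ, ℝ).prod 𝓘(ℝ, E3))
      (b := fun p : ℝ × E3 ↦ p.2) (s := fun p : ℝ × E3 ↦ (O p.1).coordK p.2) hs).2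
      ⟨contMDiffOn_snd, toM hK⟩⟩

/-! ## §2 The stub -/

/-- **Stub `stub_unitAnnulusGluing_of_gluingFamily`** (registered signature, line
`receding-annulus-universal-collar`, crux item stmt-FinalStateConjecture-10052): PARAMETRIC
obstruction-free annular gluing at unit scale onto a fixed exterior Schwarzschild slice, derived
from the posited parametric Mao–Oh–Tao theorem `GluingFamilyFor`, the explicit Schwarzschild
OUT-site package (`SchwDatum`, `SchwOutSite`) and the charge bound. Plumbing: cut the in-family
off inside radius `9/10` (so that its coefficient fields are jointly smooth on `{R⋆ < t} × ℝ³`),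
check the per-`t` hypotheses by locality of the constraints and of iterated derivatives, apply the
family theorem against the Schwarzschild datum, and read the conclusion back. Mao–Oh–Tao 2023,
Thm 1.7, Rem 1.9, Rem 1.11; Corvino 2000, §4. [folklore] -/
theorem stub_unitAnnulusGluing_of_gluingFamily :
    (∀ η : ℝ → ℝ, IsBump η → GluingFamilyFor η) →
    (∀ m : ℝ, 0 < m → ∃ S : InitialDataSet (𝓡 3) E3, SchwDatum m S) →
    (∀ η : ℝ → ℝ, IsBump η → ∀ (εo μo μ₀ : ℝ), 0 < εo → 0 < μo → 0 < μ₀ →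
      ∃ (m sOut θ : ℝ), 0 < m ∧ m ≤ μ₀ ∧ 0 < θ ∧ SchwOutSite η εo μo m sOut θ) →
    (∀ η : ℝ → ℝ, IsBump η → ∃ Cη : ℝ, 0 < Cη ∧
      ∀ (g k : E3 → E3 →L[ℝ] E3 →L[ℝ] ℝ) (s : ℝ), ContDiff ℝ 1 g → 0 ≤ s → DevLE g k 1 2 s →
        |avgE η 1 g| ≤ Cη * s ∧ (∀ i, |avgP η 1 k i| ≤ Cη * s) ∧
          (∀ i, |avgC η 1 g i| ≤ Cη * s) ∧ (∀ i, |avgJ η 1 k i| ≤ Cη * s)) →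
    ∃ (η δ₀ : ℝ), 0 < η ∧ 0 < δ₀ ∧
      ∀ (Rstar : ℝ) (I : ℝ → InitialDataSet (𝓡 3) E3),
        SmoothSectionsOn 𝓘(ℝ, ℝ) I {p : ℝ × E3 | Rstar < p.1 ∧ 1 / 2 < ‖p.2‖} →
        (∀ R : ℝ, Rstar < R → VacuumOn {y | 1 / 2 < ‖y‖} (I R)) →
        (∀ R : ℝ, Rstar < R → ∀ y : E3, 1 ≤ ‖y‖ → ‖y‖ ≤ 4 →
          (∀ i ≤ 2, ‖iteratedFDeriv ℝ i
              (fun z : E3 ↦ (I R).coordH z - (innerSL ℝ : E3 →L[ℝ] E3 →L[ℝ] ℝ)) y‖ ≤ δ₀) ∧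
          (∀ i ≤ 1, ‖iteratedFDeriv ℝ i (I R).coordK y‖ ≤ δ₀)) →
        ∃ O : ℝ → InitialDataSet (𝓡 3) E3,
          SmoothSectionsOn 𝓘(ℝ, ℝ) O {p : ℝ × E3 | Rstar < p.1 ∧ 1 < ‖p.2‖} ∧
          ∀ R : ℝ, Rstar < R →
            VacuumOn {y | 1 < ‖y‖} (O R) ∧
            (∀ y : E3, 1 < ‖y‖ → ‖y‖ < 2 → (O R).h.inner y = (I R).h.inner y ∧ (O R).k y = (I R).k y) ∧
            IsIsotropicBeyond η 32 (O R) := by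
  intro hG hSD hSO hCB
  classical
  -- (0) the constants
  obtain ⟨η, hη⟩ := exists_isBump
  obtain ⟨εo, μo, hεo, hμo, hGF⟩ := hG η hη
  obtain ⟨m, sOut, θ, hm, -, hθ, hsite⟩ := hSO η hη εo μo 1 hεo hμo one_pos
  obtain ⟨S, hS⟩ := hSD m hm
  obtain ⟨Cη, hCη, hcb⟩ := hCB η hη
  obtain ⟨δ₀, hδ₀_def⟩ : ∃ δ₀ : ℝ, δ₀ = min θ (θ / Cη) := ⟨_, rfl⟩
  have hδ₀ : 0 < δ₀ := by rw [hδ₀_def]; exact lt_min hθ (div_pos hθ hCη)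
  have hδθ : δ₀ ≤ θ := by rw [hδ₀_def]; exact min_le_left _ _
  have hCδ : Cη * δ₀ ≤ θ := by
    have hC0 : Cη ≠ 0 := hCη.ne'
    have h1 : Cη * δ₀ ≤ Cη * (θ / Cη) :=
      mul_le_mul_of_nonneg_left (by rw [hδ₀_def]; exact min_le_right _ _) hCη.le
    have h2 : Cη * (θ / Cη) = θ := by field_simp
    linarith
  refine ⟨m, δ₀, hm, hδ₀, fun Rstar I hIs hIvac hIsmall ↦ ?_⟩
  -- (1) the cut-off `χ = 1` on `{‖y‖ < 27/40}`, `χ = 0` on `{9/10 ≤ ‖y‖}`, and the cut-off family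
  obtain ⟨χ, hχ_def⟩ :
      ∃ χ : E3 → ℝ, χ = fun y ↦ Real.smoothTransition (4 - ‖y‖ ^ 2 / (9 / 20 : ℝ) ^ 2) :=
    ⟨_, rfl⟩
  have hχs : ContDiff ℝ ∞ χ := by rw [hχ_def]; exact contDiff_cutoff _
  have hχ01 : ∀ y, 0 ≤ χ y ∧ χ y ≤ 1 := fun y ↦ by
    rw [hχ_def]; exact ⟨Real.smoothTransition.nonneg _, Real.smoothTransition.le_one _⟩
  have hχ0 : ∀ y : E3, 9 / 10 ≤ ‖y‖ → χ y = 0 := fun y hy ↦ by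
    rw [hχ_def]; exact cutoff_eq_zero (by norm_num) (by linarith)
  have hχ1 : ∀ y : E3, ‖y‖ < 27 / 40 → χ y = 1 := fun y hy ↦ by
    rw [hχ_def]; exact cutoff_eq_one (by norm_num) (by linarith)
  choose Din hDinH hDinK using fun t : ℝ ↦
    unitGluing_exists_cutoffDatum (innerSL ℝ) (fun v w ↦ real_inner_comm w v)
      (fun v hv ↦ real_inner_self_pos.2 hv) hχs hχ01 (I t)
  have hagreeH : ∀ (t : ℝ) (z : E3), 9 / 10 ≤ ‖z‖ → (Din t).coordH z = (I t).coordH z := by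
    intro t z hz
    rw [hDinH t]
    refine ContinuousLinearMap.ext fun v ↦ ContinuousLinearMap.ext fun w ↦ ?_
    simp only [hχ0 z hz, add_apply, smul_apply, smul_eq_mul, zero_mul, zero_add, sub_zero, one_mul]
  have hagreeK : ∀ (t : ℝ) (z : E3), 9 / 10 ≤ ‖z‖ → (Din t).coordK z = (I t).coordK z := by
    intro t z hz
    rw [hDinK t]
    refine ContinuousLinearMap.ext fun v ↦ ContinuousLinearMap.ext fun w ↦ ?_
    simp only [hχ0 z hz, smul_apply, smul_eq_mul, sub_zero, one_mul]
  have hmem : ∀ x : E3, 9 / 10 < ‖x‖ → {z : E3 | 9 / 10 < ‖z‖} ∈ 𝓝 x := fun x hx ↦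
    (isOpen_lt continuous_const continuous_norm).mem_nhds hx
  have hevH : ∀ (t : ℝ) (x : E3), 9 / 10 < ‖x‖ → (Din t).coordH =ᶠ[𝓝 x] (I t).coordH :=
    fun t x hx ↦ Filter.eventuallyEq_of_mem (hmem x hx) fun z hz ↦ hagreeH t z (le_of_lt hz)
  have hevK : ∀ (t : ℝ) (x : E3), 9 / 10 < ‖x‖ → (Din t).coordK =ᶠ[𝓝 x] (I t).coordK :=
    fun t x hx ↦ Filter.eventuallyEq_of_mem (hmem x hx) fun z hz ↦ hagreeK t z (le_of_lt hz)
  -- (2) joint smoothness of the cut-off family on `{R⋆ < t} × ℝ³`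
  have hopen : IsOpen {p : ℝ × E3 | Rstar < p.1 ∧ 1 / 2 < ‖p.2‖} :=
    (isOpen_lt continuous_const continuous_fst).inter
      (isOpen_lt continuous_const (continuous_norm.comp continuous_snd))
  obtain ⟨hIH, hIK⟩ := unitGluing_contDiffOn_coord_of_smoothSectionsOn hopen hIs
  have hχ2 : ∀ q : ℝ × E3, ContDiffAt ℝ ∞ (fun p : ℝ × E3 ↦ χ p.2) q := fun q ↦
    hχs.contDiffAt.comp q contDiffAt_snd
  have hnear : ∀ q : ℝ × E3, ¬ 1 / 2 < ‖q.2‖ → ∀ᶠ p : ℝ × E3 in 𝓝 q, χ p.2 = 1 := by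
    intro q hq
    have hq' : ‖q.2‖ < 27 / 40 := by linarith [not_lt.1 hq]
    have hev : ∀ᶠ p : ℝ × E3 in 𝓝 q, ‖p.2‖ < 27 / 40 :=
      (isOpen_lt (continuous_norm.comp continuous_snd) continuous_const).mem_nhds hq'
    exact hev.mono fun p hp ↦ hχ1 p.2 hp
  have hjH : ContDiffOn ℝ ∞ (fun p : ℝ × E3 ↦ (Din p.1).coordH p.2) ({t | Rstar < t} ×ˢ univ) := by
    have hfun : (fun p : ℝ × E3 ↦ (Din p.1).coordH p.2) =
        fun p ↦ χ p.2 • (innerSL ℝ : E3 →L[ℝ] E3 →L[ℝ] ℝ) + (1 - χ p.2) • (I p.1).coordH p.2 := by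
      funext p
      rw [hDinH p.1]
    rw [hfun]
    rintro ⟨t, y⟩ ⟨ht, -⟩
    change Rstar < t at ht
    apply ContDiffAt.contDiffWithinAt
    by_cases hy : 1 / 2 < ‖y‖
    · exact ((hχ2 _).smul contDiffAt_const).add
        ((contDiffAt_const.sub (hχ2 _)).smul (hIH.contDiffAt (hopen.mem_nhds ⟨ht, hy⟩)))
    · refine (contDiffAt_const (c := (innerSL ℝ : E3 →L[ℝ] E3 →L[ℝ] ℝ))).congr_of_eventuallyEq ?_
      filter_upwards [hnear (t, y) hy] with p hp
      rw [hp]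
      refine ContinuousLinearMap.ext fun v ↦ ContinuousLinearMap.ext fun w ↦ ?_
      simp only [add_apply, smul_apply, smul_eq_mul, one_mul, sub_self, zero_mul, add_zero]
  have hjK : ContDiffOn ℝ ∞ (fun p : ℝ × E3 ↦ (Din p.1).coordK p.2) ({t | Rstar < t} ×ˢ univ) := by
    have hfun : (fun p : ℝ × E3 ↦ (Din p.1).coordK p.2) =
        fun p ↦ (1 - χ p.2) • (I p.1).coordK p.2 := by
      funext p
      rw [hDinK p.1]
    rw [hfun]
    rintro ⟨t, y⟩ ⟨ht, -⟩
    change Rstar < t at ht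
    apply ContDiffAt.contDiffWithinAt
    by_cases hy : 1 / 2 < ‖y‖
    · exact (contDiffAt_const.sub (hχ2 _)).smul (hIK.contDiffAt (hopen.mem_nhds ⟨ht, hy⟩))
    · refine (contDiffAt_const (c := (0 : E3 →L[ℝ] E3 →L[ℝ] ℝ))).congr_of_eventuallyEq ?_
      filter_upwards [hnear (t, y) hy] with p hp
      rw [hp, sub_self]
      exact zero_smul ℝ ((I p.1).coordK p.2)
  -- (3) the per-`t` hypotheses
  have hvac : ∀ t, Rstar < t → (Din t).VacOn 1 2 := by
    intro t ht inst y hy1 hy2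
    haveI := (I t).metric.hasLeviCivita
    have hy : 9 / 10 < ‖y‖ := by linarith
    exact (isVacuumAt_congr (hevH t y hy) (hevK t y hy)).2
      (hIvac t ht y (show 1 / 2 < ‖y‖ by linarith))
  have hdev : ∀ t, Rstar < t → DevLE (Din t).coordH (Din t).coordK 1 2 δ₀ := by
    intro t ht x hx1 hx2
    have hx : 9 / 10 < ‖x‖ := by linarith
    obtain ⟨hH, hK⟩ := hIsmall t ht x hx1 (by linarith)
    refine ⟨fun i hi ↦ ?_, fun i hi ↦ ?_⟩
    · have heq : (fun z ↦ (Din t).coordH z - (innerSL ℝ : E3 →L[ℝ] E3 →L[ℝ] ℝ)) =ᶠ[𝓝 x]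
          fun z ↦ (I t).coordH z - (innerSL ℝ : E3 →L[ℝ] E3 →L[ℝ] ℝ) := by
        filter_upwards [hevH t x hx] with z hz
        rw [hz]
      rw [(heq.iteratedFDeriv ℝ i).eq_of_nhds]
      exact hH i hi
    · rw [((hevK t x hx).iteratedFDeriv ℝ i).eq_of_nhds]
      exact hK i hi
  have hC1 : ∀ t, ContDiff ℝ 1 (Din t).coordH := fun t ↦
    (Din t).contMDiff_coordH.contDiff.of_le (by exact_mod_cast le_top)
  have hmot : ∀ t, Rstar < t →
      MOTHyp η εo μo (Din t).coordH (Din t).coordK S.coordH S.coordK δ₀ sOut := by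
    intro t ht
    obtain ⟨hE, hP, hC, hJ⟩ := hcb (Din t).coordH (Din t).coordK δ₀ (hC1 t) hδ₀.le (hdev t ht)
    exact hsite S hS _ _ δ₀ (hdev t ht) hδ₀.le hδθ (hE.trans hCδ) (fun i ↦ (hP i).trans hCδ)
      (fun i ↦ (hC i).trans hCδ) (fun i ↦ (hJ i).trans hCδ)
  have hSvac : S.VacOn 32 64 := by
    intro inst y hy1 hy2
    exact hS.2 y (by linarith)
  -- (4) the family theorem
  obtain ⟨D, hDh, hDk, hD⟩ := hGF Rstar Din S (fun _ ↦ δ₀) sOut hjH hjK hSvac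
    (fun t ht ↦ ⟨hvac t ht, hmot t ht⟩)
  -- (5) read back
  have hopen1 : IsOpen {p : ℝ × E3 | Rstar < p.1 ∧ 1 < ‖p.2‖} :=
    (isOpen_lt continuous_const continuous_fst).inter
      (isOpen_lt continuous_const (continuous_norm.comp continuous_snd))
  have hsub : {p : ℝ × E3 | Rstar < p.1 ∧ 1 < ‖p.2‖} ⊆ {t | Rstar < t} ×ˢ (univ : Set E3) :=
    fun p hp ↦ ⟨hp.1, mem_univ _⟩
  refine ⟨D, unitGluing_smoothSectionsOn_of_contDiffOn hopen1 hsub hDh hDk, fun R hR ↦ ⟨?_, ?_, ?_⟩⟩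
  · -- vacuum on `{1 < ‖y‖}`: the glued datum below radius `64`, the Schwarzschild datum beyond `32`
    intro inst y hy
    change 1 < ‖y‖ at hy
    by_cases h64 : ‖y‖ < 64
    · exact (hD R hR).1 y hy h64
    · haveI := S.metric.hasLeviCivita
      have h32 : (32 : ℝ) < ‖y‖ := by linarith [not_lt.1 h64]
      have hev : ∀ᶠ z in 𝓝 y, (32 : ℝ) < ‖z‖ :=
        (isOpen_lt continuous_const continuous_norm).mem_nhds h32
      exact (isVacuumAt_congr (hev.mono fun z hz ↦ ((hD R hR).2.2 z hz).1)
        (hev.mono fun z hz ↦ ((hD R hR).2.2 z hz).2)).2 (hS.2 y (by linarith))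
  · -- agreement with `I R` on `{1 < ‖y‖ < 2}`
    intro y hy1 hy2
    obtain ⟨hh, hk⟩ := (hD R hR).2.1 y hy2
    exact ⟨hh.trans (hagreeH R y (by linarith)), hk.trans (hagreeK R y (by linarith))⟩
  · -- exactly isotropic Schwarzschild(`m`) beyond radius `32`
    intro y hy
    obtain ⟨hh, hk⟩ := (hD R hR).2.2 y hy
    obtain ⟨h1, h2⟩ := hS.1 y (by linarith)
    refine ⟨?_, hk.trans h2⟩
    rw [hh]
    refine ContinuousLinearMap.ext fun v ↦ ContinuousLinearMap.ext fun w ↦ ?_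
    rw [h1 v w]
    rfl

end Summit.FinalStateConjecture.FinalStateConjecture.Theorems.SwallowTheDatum.ParametricKerrBurial

end
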